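import Literature.NumberTheory.Transcendental.BrownZagierFormulaProofs
import Literature.NumberTheory.Transcendental.MultipleZetaNewtonProofs
import HarnessLib

/-!
# Brown, *Mixed Tate motives over ℤ* (2012), §2 in `𝒰`-coordinates: the motivic input
# `(H, Iᵐ, per, H ↪ 𝒰)` AS PRINTED, and everything else derived

Sibling file of `BrownDepthOneLift.lean` / `BrownZagierFormulaProofs.lean`, in the cone of the named
fact `Literature.NumberTheory.Transcendental.hoffmanSpan_eq_mzvSpace` (Brown 2012, Theorem 1.1 ⟹
Hoffman's Conjecture 2). Those files reduce the fact to an inhabitant of `Brown2012.UCoactionData`,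
a hypothesis bundle that still carries three pieces of ABSTRACT data which Brown constructs rather
than assumes — the Lie coalgebra pieces `𝔏_{2r+1}` with `π_r`, the `𝔏_{2r+1} ⊗ H`-valued
derivations `D_{2r+1}`, and the functionals "`ζ_{2r+1} ↦ 1`" — and one non-structural axiom
(`lemma_3_8`, the motivic Lemma 3.8 in its final form).

This file replaces it by `Brown2012.MotivicMZV`, whose fields are, one by one, statements printed in
§2 and §3.1 of the paper about the algebra `H` of motivic multiple zeta values **seen inside
`𝒰 = ℚ⟨f₃, f₅, …⟩ ⊗ ℚ[f₂]` through (2.15) and (2.22)**: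

* `H` graded by the weight, `Iᵐ(0; u; 1) ∈ H_{|u|}` ((2.16)), I1 and I0 (§2.4);
* the period map `per : H → ℝ`, an algebra homomorphism with `per ζᵐ(n₁,…,n_r) = ζ(n₁,…,n_r)`
  ((2.11), (2.19));
* `φ : H → 𝒰`, weight-preserving and injective on each `H_N` — the injective morphism of graded
  algebra comodules (2.15) followed by an isomorphism (2.22);
* for `r ≥ 1` the operator `∂ʰ_{2r+1} = (f^∨_{2r+1} ⊗ id) ∘ D_{2r+1} : H → H` (Definition 3.1
  contracted with the functional `f^∨_{2r+1}` of the proof of Lemma 2.7, through `φ`), which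
  (i) is intertwined by `φ` with `∂_{2r+1}` = "remove the initial letter `f_{2r+1}`" on `𝒰`
  (`φ` is a comodule morphism — the commutative square in the proof of Theorem 3.3),
  (ii) is a derivation ((3.3)), and (iii) acts on `Iᵐ(0; v; 1)` by Goncharov's formula (3.4)
  (Theorem 2.4 = [Goncharov 2005, Theorem 1.2]) with the coefficient of `f_{2r+1}` in
  `φ(Iᵐ(window))` in place of `π(Iᵐ(window))`;
* the coefficient of `f_{2r+1}` in `φ(x y)` vanishes for `x, y` of positive weight (`φ` is an
  algebra homomorphism and a shuffle product of non-trivial monomials has no one-letter term —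
  this is "`π` kills products", (3.1));
* (3.8): `ζᵐ₁(2^{n}) = -2 ∑ ζᵐ(2^{i} 3 2^{n-1-i})`, the instance of the shuffle regularisation I2
  that is used ("which follows immediately from relation I2").

Nothing else: no `𝔏`, no `D_{2r+1}`, no choice of functional, no normalisation (3.6), no
Lemma 3.8 and NO MOTIVIC STUFFLE (Brown proves Lemma 3.8 "granting the motivic stuffle product
formula [9, 10] for our version of motivic multiple zeta values in which `ζᵐ(2)` is non zero", or
"alternatively" by "the general method for lifting relations from real multiple zeta values to
their motivic versions" — the file takes the second road and needs only the REAL stuffle, a theorem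
of the tree), no Theorem 3.3, no dimension bound. From these the file PROVES

* `MotivicMZV.dH_J_rho_singleton`, `dH_J_rho_self` — (3.9); `dH_J_rho_replicate_two` — Lemma 3.4;
* `MotivicMZV.φ_zeta` — Lemma 3.2 / (3.6) up to a unit: `φ(ζᵐ(N)) = α_N f_N` with `α_N ≠ 0`
  (Lemma 2.7 on `𝒰`, injectivity of (2.15) and `per ζᵐ(N) = ζ(N) > 0`); `MotivicMZV.kernel` —
  Theorem 3.3 for `∂ʰ`;
* `MotivicMZV.lemma_3_5`, `coeff_ξ`, `sum_coeff_ξ` — Lemma 3.5 contracted with `f^∨_{2r+1} ∘ φ`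
  (window calculus of `BrownWindowCalculus`), its coefficient, and its sum over the position of the
  `3` (`∑_{a+b=n-1} [f_{2r+1}] φ(ξ^r_{a,b}) = ∑_{α+β+1=r} [f_{2r+1}] φ(ζᵐ(2^α32^β))`);
* `MotivicMZV.Y_eq_zero`, `MotivicMZV.lemma_3_8` — **Lemma 3.8 LIFTED from the real identity**: with
  `Y_n := ∑_{a+b=n-1} ζᵐ(2^a32^b) + ∑_{i=1}^{n} (-1)^i ζᵐ(2i+1) ζᵐ(2^{n-i})`, by induction
  `∂ʰ_{<2n+1} Y_n = 0` (`dH_Y_eq_zero`: Lemma 3.5 summed, and Lemma 3.8 in lower weight read modulo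
  products, `sum_coeff_tt_of_Y_eq_zero`), hence `Y_n ∈ ℚ ζᵐ(2n+1)` by Theorem 3.3, and `per Y_n = 0`
  (`per_Y`: the alternating sum of the stuffle rows for REAL multiple zeta values,
  `sum_multipleZeta_twos_insert_three`) with `ζ(2n+1) > 0` gives `Y_n = 0`; then (3.8);
* `MotivicMZV.normalize` — the normalisation (3.6) `φ(ζᵐ(2r+1)) = f_{2r+1}`, obtained as in the
  paper by composing `φ` with the automorphism of `𝒰` rescaling the letters `f_{2r+1}`
  (`scaleU`), with `∂ʰ` rescaled accordingly (`normalized_normalize`); the condition itself,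
  `MotivicMZV.Normalized`, is a HYPOTHESIS on a structure (a predicate `MotivicMZV → Prop`, not a
  closed statement: a general rescaling `rescale` un-normalises, `forall_normalized_iff_isEmpty`);
* `MotivicMZV.toUCoactionData` — Brown's `UCoactionData` with `𝔏_{2r+1} := ℚ`,
  `π_r :=` the coefficient of `f_{2r+1}`, `D_{2r+1} := 1 ⊗ ∂ʰ_{2r+1}`, `ζ_{2r+1} ↦ 1 := id`;
* `hoffmanSpan_eq_mzvSpace_of_motivicMZV` — **the named fact from `MotivicMZV` alone** (with
  `BrownZagierFormulaProofs`: Zagier's theorem is a theorem of the tree), and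
  `finrank_mzvSpace_le_zagierDim_of_motivicMZV` — Terasoma's bound (the other `periods.S24` fact)
  from the same input.

So the single remaining external input of the formalisation of Brown's paper is now literally
"the objects of §2 exist": motivic MZVs with their period map, Goncharov's coaction and the
embedding into `H^{MT⁺} ≅ 𝒰` — i.e. the category `MT(ℤ)` ([Deligne–Goncharov 2005], Borel) and the
motivic fundamental groupoid of `ℙ¹ ∖ {0, 1, ∞}` ([Goncharov 2005]), absent from Mathlib. No named
fact is introduced (`MotivicMZV` is a hypothesis bundle, D-0026).

## References

* F. Brown, *Mixed Tate motives over ℤ*, Ann. of Math. **175** (2012), 949–976 (arXiv:1102.1312):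
  §2.2 Definition 2.1, (2.11); §2.3 (2.15); §2.4 (2.16), I0–I3, Theorem 2.4, (2.19); §2.5
  (2.20)–(2.22), Lemma 2.7; §3.1 Definition 3.1, (3.3), (3.4); Lemma 3.2, (3.6), Theorem 3.3,
  (3.8), (3.9), Lemma 3.8. [Brown2012]
* A. B. Goncharov, *Galois symmetries of fundamental groupoids and noncommutative geometry*, Duke
  Math. J. **128** (2005), Theorem 1.2. [Goncharov2005]
* P. Deligne, A. B. Goncharov, *Groupes fondamentaux motiviques de Tate mixte*, Ann. Sci. ÉNS **38**
  (2005). [DeligneGoncharov2005]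
-/

namespace Literature.NumberTheory.Transcendental

namespace Brown2012

open MZV

open scoped TensorProduct

/-- **Brown's motivic multiple zeta values in `𝒰`-coordinates** — the content of §2 of the paper as
printed: the weight-graded commutative `ℚ`-algebra `H` ((2.7)) with the motivic iterated integrals
`J u = Iᵐ(0; u; 1) ∈ H_{|u|}` ((2.8), (2.16)) subject to I1 and I0, the period map ((2.11), (2.19)),
the weight-preserving injection `φ : H ⊆ H^{MT⁺} ≅ 𝒰` ((2.15), (2.22)), and for `r ≥ 1` the
contracted derivation `∂ʰ_{2r+1} = (f^∨_{2r+1} ⊗ id) ∘ D_{2r+1}` of Definition 3.1: intertwined by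
`φ` with `∂_{2r+1}` on `𝒰` (comodule morphism), a derivation ((3.3)), given on `Iᵐ(0; v; 1)` by
Goncharov's formula (3.4) (Theorem 2.4) with the `f_{2r+1}`-coefficient of `φ` as the functional on
the windows; that coefficient kills products of positive-weight elements ((3.1): `φ` is an algebra
homomorphism); and (3.8) (from I2). [cite: Brown2012, §§2.2–2.5, §3.1, (3.8)] -/
structure MotivicMZV where
  /-- Brown's algebra `H` of motivic multiple zeta values (Definition 2.1). -/
  H : Type
  [instCommRing : CommRing H]
  [instAlgebra : Algebra ℚ H]
  /-- The weight-`N` piece `H_N`. -/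
  Hw : ℕ → Submodule ℚ H
  /-- The weight is multiplicative. -/
  mul_mem : ∀ {a b : ℕ} {x y : H}, x ∈ Hw a → y ∈ Hw b → x * y ∈ Hw (a + b)
  /-- `J u = Iᵐ(0; u; 1)` ((2.8)). -/
  J : List Bool → H
  /-- (2.16): `Iᵐ(0; u; 1) ∈ H_{|u|}`. -/
  J_mem : ∀ u : List Bool, J u ∈ Hw u.length
  /-- I1: `Iᵐ(0; ∅; 1) = 1`. -/
  J_nil : J [] = 1
  /-- I0 (second clause): `Iᵐ(0; a⋯a; 1) = 0`. -/
  J_replicate : ∀ (m : ℕ) (b : Bool), J (List.replicate (m + 1) b) = 0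
  /-- The period map (2.11), an algebra homomorphism. -/
  per : H →ₐ[ℚ] ℝ
  /-- (2.19): `per (ζᵐ(n₁,…,n_r)) = ζ(n₁,…,n_r)` for `n_r ≥ 2` (Brown's order of summation is the
  reverse of `multipleZeta`'s). -/
  per_J : ∀ s : List ℕ, IsAdmissible s → per (J (rho s.reverse)) = multipleZeta s
  /-- `φ : H ⊆ H^{MT⁺} ≅ 𝒰 = ℚ⟨f₃,f₅,…⟩ ⊗ ℚ[f₂]` ((2.15) followed by (2.22)). -/
  φ : H →ₗ[ℚ] (ℕ × List ℕ →₀ ℚ)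
  /-- `φ` respects the weight ((2.15) and (2.22) are graded). -/
  φ_mem : ∀ (N : ℕ) (x : H), x ∈ Hw N → φ x ∈ uWeight N
  /-- (2.15) is injective (and (2.22) is an isomorphism). -/
  φ_inj : ∀ N : ℕ, Set.InjOn φ (Hw N)
  /-- `∂ʰ_{2r+1} = (f^∨_{2r+1} ⊗ id) ∘ D_{2r+1} : H → H` (Definition 3.1, proof of Lemma 2.7). -/
  dH : ℕ → H →ₗ[ℚ] H
  /-- `φ` is a morphism of comodules: `φ ∘ ∂ʰ_{2r+1} = ∂_{2r+1} ∘ φ` (proof of Theorem 3.3). -/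
  φ_dH : ∀ r : ℕ, 1 ≤ r → ∀ x : H, φ (dH r x) = dU r (φ x)
  /-- (3.3): `D_{2r+1}`, hence `∂ʰ_{2r+1}`, is a derivation. -/
  dH_mul : ∀ (r : ℕ) (x y : H), dH r (x * y) = x * dH r y + y * dH r x
  /-- (3.4) (Theorem 2.4, [Goncharov2005, Theorem 1.2]) contracted with `f^∨_{2r+1} ∘ φ`:
  `∂ʰ_{2r+1} Iᵐ(0;v;1) = ∑_windows [f_{2r+1}] φ(Iᵐ(window)) · Iᵐ(0; quotient; 1)`. -/
  dH_J : ∀ r : ℕ, 1 ≤ r → ∀ v : List Bool,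
    dH r (J v) = ∑ p ∈ Finset.range (v.length + 1 - (2 * r + 1)),
      φ (Im J (lft v p) (inner v (2 * r + 1) p) (rgt v (2 * r + 1) p)) (0, [2 * r + 1]) •
        J (quot v (2 * r + 1) p)
  /-- (3.1): the coefficient of `f_{2r+1}` (`π`) kills products of positive-weight elements. -/
  coeff_mul : ∀ (r : ℕ) {a b : ℕ} {x y : H}, 1 ≤ a → 1 ≤ b → x ∈ Hw a → y ∈ Hw b →
    φ (x * y) (0, [2 * r + 1]) = 0
  /-- (3.8) (relation I2): `ζᵐ₁(2^{n}) = -2 ∑_{i=0}^{n-1} ζᵐ(2^{i} 3 2^{n-1-i})`. -/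
  zetaOne : ∀ n : ℕ, 1 ≤ n → J (false :: rho (List.replicate n 2)) =
    -2 * ∑ i ∈ Finset.range n, J (rho (List.replicate i 2 ++ 3 :: List.replicate (n - 1 - i) 2))

attribute [instance] MotivicMZV.instCommRing MotivicMZV.instAlgebra

namespace MotivicMZV

variable (M : MotivicMZV)

/-- The coefficient of `f_{2r+1}` in `φ(x)`: Brown's functional `f^∨_{2r+1} ∘ π` through `φ`
(proof of Lemma 2.7, (3.6), (5.5)). [cite: Brown2012, proof of Lemma 2.7] -/
noncomputable def coeff (r : ℕ) : M.H →ₗ[ℚ] ℚ := Finsupp.lapply (0, [2 * r + 1]) ∘ₗ M.φ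

/-- `coeff r x = φ(x)(f_{2r+1})`. [folklore] -/
@[simp] theorem coeff_apply (r : ℕ) (x : M.H) : M.coeff r x = M.φ x (0, [2 * r + 1]) := rfl

/-- `1 = Iᵐ(0; ∅; 1) ∈ H₀`. [cite: Brown2012, §2.4 I1] -/
theorem one_mem : (1 : M.H) ∈ M.Hw 0 := by
  rw [← M.J_nil]; exact M.J_mem []

/-- `ζᵐ(N) ∈ H_N`. [cite: Brown2012, (2.16)] -/
theorem J_rho_singleton_mem {N : ℕ} (hN : 1 ≤ N) : M.J (rho [N]) ∈ M.Hw N := by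
  have := M.J_mem (rho [N])
  rwa [length_rho_of_pos (by simpa using hN), show weight [N] = N by simp [weight]] at this

/-- `ζᵐ(w) ∈ H_{|w|}` for `w ∈ {2,3}^×`. [cite: Brown2012, (2.16)] -/
theorem J_rho_mem_hoffman {w : List ℕ} (hw : IsHoffman w) : M.J (rho w) ∈ M.Hw (weight w) := by
  rw [← length_rho_of_pos (fun a ha => by have := two_le_of_isHoffman hw ha; omega)]
  exact M.J_mem _

/-! ### (3.9): `∂ʰ_{2r+1}` kills `ζᵐ(N)` for `N ≠ 2r+1` -/

/-- **(3.9)** (the vanishing part): `∂ʰ_{2r+1} ζᵐ(N) = 0` for `N ≥ 2`, `N ≠ 2r+1` — in (3.4) every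
window of `(0; 1 0^{N-1}; 1)` of length `2r+1 < N` either has equal endpoints or a constant inner
word (I0). [cite: Brown2012, (3.9) and proof of Lemma 3.2] -/
theorem dH_J_rho_singleton {r N : ℕ} (hr : 1 ≤ r) (hN : 2 ≤ N) (hNr : N ≠ 2 * r + 1) :
    M.dH r (M.J (rho [N])) = 0 := by
  set n := 2 * r + 1 with hn
  have hv : rho [N] = true :: List.replicate (N - 1) false := by simp [rhoLetter]
  have hlen : (rho [N]).length = N := by rw [hv]; simp; omega
  rw [M.dH_J r hr, hlen]
  refine Finset.sum_eq_zero fun p hp => ?_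
  have hp' := Finset.mem_range.1 hp
  rcases Nat.eq_zero_or_pos p with rfl | hpos
  · -- the window at `0`: right endpoint `a_{n+1} = 0 = a₀`
    rw [← hn, lft_zero, rgt_of_lt (by rw [hlen]; omega)]
    have : (rho [N])[0 + n]'(by rw [hlen]; omega) = false := by
      simp only [hv, Nat.zero_add]
      rw [List.getElem_cons]
      simp [show n ≠ 0 by omega]
    rw [this, Im_self _ _ (by rw [← List.length_pos_iff, length_inner (by rw [hlen]; omega)]; omega),
      map_zero, Finsupp.zero_apply, zero_smul]
  · -- the inner word is `0^n`
    have hinner : inner (rho [N]) n p = List.replicate n false := by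
      rw [inner, hv, show p = (p - 1) + 1 by omega, List.drop_succ_cons, List.drop_replicate,
        List.take_replicate]
      congr 1
      omega
    rw [← hn, hinner, show n = (n - 1) + 1 by omega,
      Im_replicate_false_eq_zero (fun m => M.J_replicate m false), map_zero, Finsupp.zero_apply,
      zero_smul]

/-! ### Lemma 3.2 / (3.6) up to a unit: `φ(ζᵐ(N)) ∈ ℚ^× f_N` -/

/-- `ζᵐ(N) ≠ 0` for `N ≥ 2`: its period is `ζ(N) > 0`. [cite: Brown2012, Lemma 3.2] -/
theorem J_rho_singleton_ne_zero {N : ℕ} (hN : 2 ≤ N) : M.J (rho [N]) ≠ 0 := by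
  intro h0
  have hadm : IsAdmissible [N] := MZV.isAdmissible_singleton_of_two_le hN
  have hper := M.per_J [N] hadm
  rw [List.reverse_singleton, h0, map_zero] at hper
  exact absurd hper.symm (multipleZeta_pos_of_isAdmissible_holds hadm).ne'

/-- **`φ(ζᵐ(N)) = α_N f_N` with `α_N ∈ ℚ^×`** (`N ≥ 2`) — Lemma 3.2's "`φ` maps `ζᵐ(2n+1)` to
`α_n f_{2n+1}` … taking the period map yields `α_n ≠ 0`" and (3.5)/Definition 2.6 for even `N`:
by (3.9) and the comodule morphism `φ`, `φ(ζᵐ(N))` is killed by every `∂_{2r+1}`, `2r+1 < N`, so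
Lemma 2.7 applies; `α_N ≠ 0` by the injectivity of (2.15) and `ζᵐ(N) ≠ 0`.
[cite: Brown2012, Lemma 3.2, (3.5), (3.6)] -/
theorem φ_zeta {N : ℕ} (hN : 2 ≤ N) : ∃ c : ℚ, c ≠ 0 ∧ M.φ (M.J (rho [N])) = c • fU N := by
  have hmem := M.J_rho_singleton_mem (N := N) (by omega)
  have hD : ∀ r : ℕ, 1 ≤ r → 2 * r + 1 < N → dU r (M.φ (M.J (rho [N]))) = 0 := by
    intro r hr hlt
    rw [← M.φ_dH r hr, M.dH_J_rho_singleton hr hN (by omega), map_zero]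
  obtain ⟨c, hc⟩ := lemma_2_7 (M.φ_mem N _ hmem) hD
  refine ⟨c, ?_, hc⟩
  rintro rfl
  rw [zero_smul] at hc
  have h0 : M.J (rho [N]) = 0 :=
    M.φ_inj N hmem (Submodule.zero_mem _) (by rw [hc, map_zero])
  exact M.J_rho_singleton_ne_zero hN h0

/-- The coefficient `α_r` of `f_{2r+1}` in `φ(ζᵐ(2r+1))` is non-zero (`r ≥ 1`).
[cite: Brown2012, Lemma 3.2] -/
theorem coeff_zeta_ne_zero {r : ℕ} (hr : 1 ≤ r) : M.coeff r (M.J (rho [2 * r + 1])) ≠ 0 := by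
  obtain ⟨c, hc0, hc⟩ := M.φ_zeta (N := 2 * r + 1) (by omega)
  rw [coeff_apply, hc, fU, if_pos ⟨r, rfl⟩]
  simpa using hc0

/-! ### Window data, Lemma 3.4 and the contracted Lemma 3.5 -/

/-- `M` as window data (`BrownWindowCalculus`): `T r := H`, `B r h y := ([f_{2r+1}] φ h) • y`,
`D r := ∂ʰ_{2r+1}`. [cite: Brown2012, (3.4)] -/
noncomputable abbrev toWindowData : WindowData where
  H := M.H
  J := M.J
  T := fun _ => M.H
  B := fun r => (LinearMap.lsmul ℚ M.H).comp (M.coeff r)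
  D := M.dH
  coaction := fun r hr v => by
    rw [M.dH_J r hr v]
    rfl

/-- **Lemma 3.4** (coaction part): `∂ʰ_{2r+1} ζᵐ(2^{n}) = 0`. [cite: Brown2012, Lemma 3.4] -/
theorem dH_J_rho_replicate_two {r : ℕ} (hr : 1 ≤ r) (n : ℕ) :
    M.dH r (M.J (rho (List.replicate n 2))) = 0 :=
  M.toWindowData.D_z_replicate_two hr n

/-- **(3.9)**, the case `N = 2r+1`: `∂ʰ_{2r+1} ζᵐ(2r+1) = α_r · 1` (the whole sequence is the only
window; its quotient is `Iᵐ(0; ∅; 1) = 1`). [cite: Brown2012, (3.9) and Lemma 3.2] -/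
theorem dH_J_rho_self {r : ℕ} (hr : 1 ≤ r) :
    M.dH r (M.J (rho [2 * r + 1])) = M.coeff r (M.J (rho [2 * r + 1])) • (1 : M.H) := by
  set n := 2 * r + 1 with hn
  have hv : rho [n] = true :: List.replicate (n - 1) false := by simp [rhoLetter]
  have hlen : (rho [n]).length = n := by rw [hv]; simp; omega
  rw [M.dH_J r hr, hlen, ← hn, show n + 1 - n = 1 by omega, Finset.sum_range_one, lft_zero, inner_zero,
    rgt_of_eq (by rw [hlen, zero_add]), Im_false_true, quot_zero, List.take_of_length_le hlen.le,
    List.drop_of_length_le hlen.le, M.J_nil, coeff_apply]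

/-- Brown's `ξ^r_{a,b}` of **Lemma 3.5**, the sum over the contributing windows of
`(0; ρ(2^a32^b); 1)`: `∑ ζᵐ(2^α32^β) - ∑ ζᵐ(2^β32^α) + (I(b ≥ r) - I(a ≥ r)) ζᵐ₁(2^r)`.
[cite: Brown2012, Lemma 3.5] -/
def ξ (r a b : ℕ) : M.H :=
  ∑ i ∈ Finset.range ((tt a b).length + 1),
    ((if K1 (tt a b) r i then M.J (rho (vK (tt a b) r i)) else 0) -
      (if K1 (tt a b) r i ∧ i + r < (tt a b).length then M.J (rho (vK (tt a b) r i).reverse) else 0) +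
      (if T1 (tt a b) r i then M.J (false :: rho (List.replicate r 2)) else 0) -
      (if T2 (tt a b) r i then M.J (false :: rho (List.replicate r 2)) else 0))

/-- **Lemma 3.5, contracted** (from (3.4) through the window calculus of `BrownWindowCalculus`):
`∂ʰ_{2r+1} ζᵐ(2^a 3 2^b) = ([f_{2r+1}] φ(ξ^r_{a,b})) · ζᵐ(2^{a+b+1-r})`. [cite: Brown2012, Lemma 3.5] -/
theorem lemma_3_5 {r : ℕ} (hr : 1 ≤ r) (a b : ℕ) :
    M.dH r (M.J (rho (tt a b))) =
      M.coeff r (M.ξ r a b) • M.J (rho (List.replicate (a + b + 1 - r) 2)) := by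
  have h := M.toWindowData.lhs_eq_rhs_of_level_le_one hr (isHoffman_tt a b) (by rw [level_tt]) []
  rw [← WindowData.D_z_eq_lhs _ hr] at h
  change M.dH r (M.J (rho (tt a b))) = M.toWindowData.rhs r [] (tt a b) at h
  rw [h, WindowData.rhs, ξ, map_sum, Finset.sum_smul]
  refine Finset.sum_congr rfl fun i _ => ?_
  set y := M.J (rho (List.replicate (a + b + 1 - r) 2)) with hy
  have e1 : M.toWindowData.gK1 r [] (tt a b) i =
      M.coeff r (if K1 (tt a b) r i then M.J (rho (vK (tt a b) r i)) else 0) • y := by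
    by_cases hK : K1 (tt a b) r i
    · rw [WindowData.gK1, if_pos hK, if_pos hK]
      show M.coeff r (M.J (rho (vK (tt a b) r i))) • M.J (rho ([] ++ qK (tt a b) r i)) = _
      rw [List.nil_append, qK_tt hK, hy]
    · rw [WindowData.gK1, if_neg hK, if_neg hK, map_zero, zero_smul]
  have e2 : M.toWindowData.gK2 r [] (tt a b) i =
      M.coeff r (if K1 (tt a b) r i ∧ i + r < (tt a b).length then
        M.J (rho (vK (tt a b) r i).reverse) else 0) • y := by
    by_cases hK : K1 (tt a b) r i ∧ i + r < (tt a b).length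
    · rw [WindowData.gK2, if_pos hK, if_pos hK]
      show M.coeff r (M.J (rho (vK (tt a b) r i).reverse)) • M.J (rho ([] ++ qK (tt a b) r i)) = _
      rw [List.nil_append, qK_tt hK.1, hy]
    · rw [WindowData.gK2, if_neg hK, if_neg hK, map_zero, zero_smul]
  have e3 : M.toWindowData.gT1 r [] (tt a b) i =
      M.coeff r (if T1 (tt a b) r i then M.J (false :: rho (List.replicate r 2)) else 0) • y := by
    by_cases hT : T1 (tt a b) r i
    · rw [WindowData.gT1, if_pos hT, if_pos hT]
      show M.coeff r (M.J (false :: rho (List.replicate r 2))) • M.J (rho ([] ++ qT (tt a b) r i)) = _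
      rw [List.nil_append, qT_tt (Or.inl hT), hy]
    · rw [WindowData.gT1, if_neg hT, if_neg hT, map_zero, zero_smul]
  have e4 : M.toWindowData.gT2 r [] (tt a b) i =
      M.coeff r (if T2 (tt a b) r i then M.J (false :: rho (List.replicate r 2)) else 0) • y := by
    by_cases hT : T2 (tt a b) r i
    · rw [WindowData.gT2, if_pos hT, if_pos hT]
      show M.coeff r (M.J (false :: rho (List.replicate r 2))) • M.J (rho ([] ++ qT (tt a b) r i)) = _
      rw [List.nil_append, qT_tt (Or.inr hT), hy]
    · rw [WindowData.gT2, if_neg hT, if_neg hT, map_zero, zero_smul]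
  rw [e1, e2, e3, e4, map_sub, map_add, map_sub, sub_smul, add_smul, sub_smul]

/-- The coefficient of `f_{2r+1}` in `φ(ξ^r_{a,b})`, reindexed by `α` (`α + β + 1 = r`):
`∑_{α ≤ a, β ≤ b} [f] φ ζᵐ(2^α32^β) - ∑_{α ≤ a, β < b} [f] φ ζᵐ(2^β32^α) + (I(b ≥ r) - I(a ≥ r)) [f] φ ζᵐ₁(2^r)`
— the bracket of the proof of Theorem 4.3, with the coefficients kept symbolic.
[cite: Brown2012, Lemma 3.5 and proof of Theorem 4.3] -/
theorem coeff_ξ {r : ℕ} (hr : 1 ≤ r) (a b : ℕ) :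
    M.coeff r (M.ξ r a b) =
      (∑ α ∈ (Finset.range r).filter (fun α => α ≤ a ∧ r - 1 - α ≤ b),
          M.coeff r (M.J (rho (tt α (r - 1 - α))))) -
        (∑ α ∈ (Finset.range r).filter (fun α => α ≤ a ∧ r - 1 - α < b),
          M.coeff r (M.J (rho (tt (r - 1 - α) α)))) +
        ((if r ≤ b then (1 : ℚ) else 0) - (if r ≤ a then 1 else 0)) *
          M.coeff r (M.J (false :: rho (List.replicate r 2))) := by
  have hlen : (tt a b).length = a + b + 1 := length_tt a b
  have S1 : ∑ i ∈ Finset.range ((tt a b).length + 1),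
      M.coeff r (if K1 (tt a b) r i then M.J (rho (vK (tt a b) r i)) else 0) =
      ∑ α ∈ (Finset.range r).filter (fun α => α ≤ a ∧ r - 1 - α ≤ b),
        M.coeff r (M.J (rho (tt α (r - 1 - α)))) := by
    rw [hlen, ← sum_K1_reindex a b r (fun α => M.coeff r (M.J (rho (tt α (r - 1 - α)))))]
    refine Finset.sum_congr rfl fun i _ => ?_
    by_cases h : i ≤ a ∧ a < i + r ∧ i + r ≤ a + b + 1
    · rw [if_pos ((K1_tt_iff hr).2 h), if_pos h, vK_tt h]
    · rw [if_neg (fun hK => h ((K1_tt_iff hr).1 hK)), if_neg h, map_zero]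
  have S2 : ∑ i ∈ Finset.range ((tt a b).length + 1),
      M.coeff r (if K1 (tt a b) r i ∧ i + r < (tt a b).length then
        M.J (rho (vK (tt a b) r i).reverse) else 0) =
      ∑ α ∈ (Finset.range r).filter (fun α => α ≤ a ∧ r - 1 - α < b),
        M.coeff r (M.J (rho (tt (r - 1 - α) α))) := by
    rw [hlen, ← sum_K2_reindex a b r (fun α => M.coeff r (M.J (rho (tt (r - 1 - α) α))))]
    refine Finset.sum_congr rfl fun i _ => ?_
    by_cases h : (i ≤ a ∧ a < i + r ∧ i + r ≤ a + b + 1) ∧ i + r < a + b + 1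
    · rw [if_pos ⟨(K1_tt_iff hr).2 h.1, h.2⟩, if_pos h, vK_tt h.1, reverse_tt]
    · rw [if_neg (fun hK => h ⟨(K1_tt_iff hr).1 hK.1, hK.2⟩), if_neg h, map_zero]
  have S3 : ∑ i ∈ Finset.range ((tt a b).length + 1),
      M.coeff r (if T1 (tt a b) r i then M.J (false :: rho (List.replicate r 2)) else 0) =
      (if r ≤ b then (1 : ℚ) else 0) * M.coeff r (M.J (false :: rho (List.replicate r 2))) := by
    simp_rw [T1_tt_iff]
    rw [Finset.sum_eq_single a]
    · by_cases h : r ≤ b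
      · rw [if_pos ⟨rfl, h⟩, if_pos h, one_mul]
      · rw [if_neg (fun h' => h h'.2), if_neg h, map_zero, zero_mul]
    · intro i _ hi
      rw [if_neg (fun h' => hi h'.1), map_zero]
    · intro h
      exact absurd (Finset.mem_range.2 (by rw [hlen]; omega)) h
  have S4 : ∑ i ∈ Finset.range ((tt a b).length + 1),
      M.coeff r (if T2 (tt a b) r i then M.J (false :: rho (List.replicate r 2)) else 0) =
      (if r ≤ a then (1 : ℚ) else 0) * M.coeff r (M.J (false :: rho (List.replicate r 2))) := by
    simp_rw [T2_tt_iff]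
    by_cases h : r ≤ a
    · rw [Finset.sum_eq_single (a - r), if_pos (by omega), if_pos h, one_mul]
      · intro i _ hi
        rw [if_neg (by omega), map_zero]
      · intro h'
        exact absurd (Finset.mem_range.2 (by rw [hlen]; omega)) h'
    · rw [if_neg h, zero_mul]
      refine Finset.sum_eq_zero fun i _ => ?_
      rw [if_neg (by omega), map_zero]
  rw [ξ, map_sum]
  simp_rw [map_sub, map_add, map_sub]
  rw [Finset.sum_sub_distrib, Finset.sum_add_distrib, Finset.sum_sub_distrib, S1, S2, S3, S4]
  ring

/-- **Summing the windows over the insertion position of the `3`**: for `1 ≤ r < n`,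
`∑_{a+b=n-1} [f_{2r+1}] φ(ξ^r_{a,b}) = ∑_{α+β+1=r} [f_{2r+1}] φ(ζᵐ(2^α32^β))` — each `ζᵐ(2^α32^β)`
occurs `n-r+1` times with `+` and `n-r` times with `-`, and the `ζᵐ₁(2^r)` terms cancel.
[cite: Brown2012, Lemma 3.5] -/
theorem sum_coeff_ξ {r n : ℕ} (hr : 1 ≤ r) (hrn : r < n) :
    ∑ a ∈ Finset.range n, M.coeff r (M.ξ r a (n - 1 - a)) =
      ∑ α ∈ Finset.range r, M.coeff r (M.J (rho (tt α (r - 1 - α)))) := by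
  have hsub : ((n - r : ℕ) : ℚ) = n - r := Nat.cast_sub hrn.le
  -- counting
  have c1 : ∀ α, α < r →
      ((Finset.range n).filter (fun a => α ≤ a ∧ r - 1 - α ≤ n - 1 - a)).card = n - r + 1 := by
    intro α hα
    have : (Finset.range n).filter (fun a => α ≤ a ∧ r - 1 - α ≤ n - 1 - a) =
        Finset.Ico α (n - r + α + 1) := by
      ext a; simp only [Finset.mem_filter, Finset.mem_range, Finset.mem_Ico]; omega
    rw [this, Nat.card_Ico]; omega
  have c2 : ∀ α, α < r →
      ((Finset.range n).filter (fun a => α ≤ a ∧ r - 1 - α < n - 1 - a)).card = n - r := by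
    intro α hα
    have : (Finset.range n).filter (fun a => α ≤ a ∧ r - 1 - α < n - 1 - a) =
        Finset.Ico α (n - r + α) := by
      ext a; simp only [Finset.mem_filter, Finset.mem_range, Finset.mem_Ico]; omega
    rw [this, Nat.card_Ico]; omega
  have c3 : ((Finset.range n).filter (fun a => r ≤ n - 1 - a)).card = n - r := by
    have : (Finset.range n).filter (fun a => r ≤ n - 1 - a) = Finset.range (n - r) := by
      ext a; simp only [Finset.mem_filter, Finset.mem_range]; omega
    rw [this, Finset.card_range]
  have c4 : ((Finset.range n).filter (fun a => r ≤ a)).card = n - r := by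
    have : (Finset.range n).filter (fun a => r ≤ a) = Finset.Ico r n := by
      ext a; simp only [Finset.mem_filter, Finset.mem_range, Finset.mem_Ico]; omega
    rw [this, Nat.card_Ico]
  -- the reflected sum
  have hG : ∑ α ∈ Finset.range r, M.coeff r (M.J (rho (tt (r - 1 - α) α))) =
      ∑ α ∈ Finset.range r, M.coeff r (M.J (rho (tt α (r - 1 - α)))) := by
    rw [← Finset.sum_range_reflect (fun α => M.coeff r (M.J (rho (tt α (r - 1 - α))))) r]
    refine Finset.sum_congr rfl fun α hα => ?_
    have hα' := Finset.mem_range.1 hα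
    simp only [show r - 1 - (r - 1 - α) = α by omega]
  -- the four sums over `a`
  have h1 : ∑ a ∈ Finset.range n, ∑ α ∈ (Finset.range r).filter (fun α => α ≤ a ∧ r - 1 - α ≤ n - 1 - a),
      M.coeff r (M.J (rho (tt α (r - 1 - α)))) =
      (((n - r : ℕ) : ℚ) + 1) * ∑ α ∈ Finset.range r, M.coeff r (M.J (rho (tt α (r - 1 - α)))) := by
    simp_rw [Finset.sum_filter]
    rw [Finset.sum_comm, Finset.mul_sum]
    refine Finset.sum_congr rfl fun α hα => ?_
    rw [← Finset.sum_filter, Finset.sum_const, nsmul_eq_mul, c1 α (Finset.mem_range.1 hα)]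
    push_cast
    ring
  have h2 : ∑ a ∈ Finset.range n, ∑ α ∈ (Finset.range r).filter (fun α => α ≤ a ∧ r - 1 - α < n - 1 - a),
      M.coeff r (M.J (rho (tt (r - 1 - α) α))) =
      ((n - r : ℕ) : ℚ) * ∑ α ∈ Finset.range r, M.coeff r (M.J (rho (tt α (r - 1 - α)))) := by
    rw [← hG, Finset.mul_sum]
    simp_rw [Finset.sum_filter]
    rw [Finset.sum_comm]
    refine Finset.sum_congr rfl fun α hα => ?_
    rw [← Finset.sum_filter, Finset.sum_const, nsmul_eq_mul, c2 α (Finset.mem_range.1 hα)]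
  have h3 : ∑ a ∈ Finset.range n,
      ((if r ≤ n - 1 - a then (1 : ℚ) else 0) - (if r ≤ a then 1 else 0)) *
        M.coeff r (M.J (false :: rho (List.replicate r 2))) = 0 := by
    rw [← Finset.sum_mul, Finset.sum_sub_distrib, Finset.sum_boole, Finset.sum_boole, c3, c4, sub_self,
      zero_mul]
  simp_rw [M.coeff_ξ hr]
  rw [Finset.sum_add_distrib, Finset.sum_sub_distrib, h1, h2, h3, hsub]
  ring

/-! ### Theorem 3.3 for `MotivicMZV` and the lifting of Lemma 3.8 from the real identity -/

/-- **Theorem 3.3** (for `∂ʰ`): an element of `H_N` (`N ≥ 2`) killed by all `∂ʰ_{2r+1}`,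
`3 ≤ 2r+1 < N`, is a rational multiple of `ζᵐ(N)` — Lemma 2.7 through `φ`, and `φ(ζᵐ(N)) = α_N f_N`.
[cite: Brown2012, Theorem 3.3] -/
theorem kernel {N : ℕ} (hN : 2 ≤ N) {x : M.H} (hx : x ∈ M.Hw N)
    (hD : ∀ r : ℕ, 1 ≤ r → 2 * r + 1 < N → M.dH r x = 0) : ∃ c : ℚ, x = c • M.J (rho [N]) := by
  have hDc : ∀ r : ℕ, 1 ≤ r → 2 * r + 1 < N → dU r (M.φ x) = 0 := by
    intro r hr hlt
    rw [← M.φ_dH r hr, hD r hr hlt, map_zero]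
  obtain ⟨c', hc'⟩ := lemma_2_7 (M.φ_mem N x hx) hDc
  obtain ⟨c, hc0, hc⟩ := M.φ_zeta hN
  refine ⟨c' / c, M.φ_inj N hx (Submodule.smul_mem _ _ (M.J_rho_singleton_mem (by omega))) ?_⟩
  rw [map_smul, hc, hc', smul_smul, div_mul_cancel₀ _ hc0]

/-- Brown's Lemma 3.8 as a vanishing statement: with (3.8) substituted,
`Y_n := ∑_{a+b=n-1} ζᵐ(2^a 3 2^b) + ∑_{i=1}^{n} (-1)^i ζᵐ(2i+1) ζᵐ(2^{n-i})` (`= 0`, Lemma 3.8).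
[cite: Brown2012, Lemma 3.8 and (3.8)] -/
def Y (n : ℕ) : M.H :=
  ∑ a ∈ Finset.range n, M.J (rho (tt a (n - 1 - a))) +
    ∑ i ∈ Finset.range n, ((-1 : ℚ) ^ (i + 1)) •
      (M.J (rho [2 * i + 3]) * M.J (rho (List.replicate (n - 1 - i) 2)))

/-- `Y_n ∈ H_{2n+1}`. [cite: Brown2012, (2.16)] -/
theorem Y_mem (n : ℕ) : M.Y n ∈ M.Hw (2 * n + 1) := by
  refine Submodule.add_mem _ (Submodule.sum_mem _ fun a ha => ?_) (Submodule.sum_mem _ fun i hi => ?_)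
  · have ha' := Finset.mem_range.1 ha
    have := M.J_rho_mem_hoffman (isHoffman_tt a (n - 1 - a))
    rwa [weight_tt, show 2 * (a + (n - 1 - a)) + 3 = 2 * n + 1 by omega] at this
  · have hi' := Finset.mem_range.1 hi
    refine Submodule.smul_mem _ _ ?_
    have hx := M.J_rho_singleton_mem (N := 2 * i + 3) (by omega)
    have hy := M.J_rho_mem_hoffman (isHoffman_replicate_two (n - 1 - i))
    rw [weight_replicate_two] at hy
    have := M.mul_mem hx hy
    rwa [show 2 * i + 3 + 2 * (n - 1 - i) = 2 * n + 1 by omega] at this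

/-- Lemma 3.8 in weight `2r+1` read modulo products ((3.12) summed): if `Y_r = 0` then
`∑_{α+β+1=r} [f_{2r+1}] φ(ζᵐ(2^α32^β)) = (-1)^{r+1} α_r`. [cite: Brown2012, (3.11)–(3.12)] -/
theorem sum_coeff_tt_of_Y_eq_zero {r : ℕ} (hr : 1 ≤ r) (hY : M.Y r = 0) :
    ∑ α ∈ Finset.range r, M.coeff r (M.J (rho (tt α (r - 1 - α)))) =
      (-1) ^ (r + 1) * M.coeff r (M.J (rho [2 * r + 1])) := by
  have h := congrArg (M.coeff r) hY
  rw [map_zero, Y, map_add, map_sum, map_sum] at h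
  have h2 : ∑ i ∈ Finset.range r, M.coeff r (((-1 : ℚ) ^ (i + 1)) •
      (M.J (rho [2 * i + 3]) * M.J (rho (List.replicate (r - 1 - i) 2)))) =
      (-1) ^ r * M.coeff r (M.J (rho [2 * r + 1])) := by
    rw [Finset.sum_eq_single (r - 1)]
    · rw [map_smul, show r - 1 - (r - 1) = 0 by omega, List.replicate_zero, rho_nil, M.J_nil, mul_one,
        show 2 * (r - 1) + 3 = 2 * r + 1 by omega, show r - 1 + 1 = r by omega, smul_eq_mul]
    · intro i hi hne
      have hi' := Finset.mem_range.1 hi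
      have hy : M.J (rho (List.replicate (r - 1 - i) 2)) ∈ M.Hw (2 * (r - 1 - i)) := by
        have := M.J_rho_mem_hoffman (isHoffman_replicate_two (r - 1 - i))
        rwa [weight_replicate_two] at this
      rw [map_smul, coeff_apply, M.coeff_mul r (a := 2 * i + 3) (b := 2 * (r - 1 - i)) (by omega) (by omega)
        (M.J_rho_singleton_mem (by omega)) hy, smul_zero]
    · intro h'
      exact absurd (Finset.mem_range.2 (by omega)) h'
  rw [h2] at h
  linear_combination h

/-- The coaction step of the lifting: if Lemma 3.8 holds in weight `2r+1` (`1 ≤ r < n`) then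
`∂ʰ_{2r+1} Y_n = 0` — Lemma 3.5 summed over the position of the `3` on the left, (3.3), (3.9) and
Lemma 3.4 on the right. [cite: Brown2012, proof of Lemma 3.8 and of Theorem 4.3] -/
theorem dH_Y_eq_zero {n r : ℕ} (hr : 1 ≤ r) (hrn : r < n) (ih : M.Y r = 0) : M.dH r (M.Y n) = 0 := by
  have hS := M.sum_coeff_tt_of_Y_eq_zero hr ih
  rw [Y, map_add, map_sum, map_sum]
  have h1 : ∑ a ∈ Finset.range n, M.dH r (M.J (rho (tt a (n - 1 - a)))) =
      ((-1 : ℚ) ^ (r + 1) * M.coeff r (M.J (rho [2 * r + 1]))) • M.J (rho (List.replicate (n - r) 2)) := by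
    rw [← hS, ← M.sum_coeff_ξ hr hrn, Finset.sum_smul]
    refine Finset.sum_congr rfl fun a ha => ?_
    have ha' := Finset.mem_range.1 ha
    rw [M.lemma_3_5 hr, show a + (n - 1 - a) + 1 - r = n - r by omega]
  have h2 : ∑ i ∈ Finset.range n, M.dH r (((-1 : ℚ) ^ (i + 1)) •
      (M.J (rho [2 * i + 3]) * M.J (rho (List.replicate (n - 1 - i) 2)))) =
      ((-1 : ℚ) ^ r * M.coeff r (M.J (rho [2 * r + 1]))) • M.J (rho (List.replicate (n - r) 2)) := by
    rw [Finset.sum_eq_single (r - 1)]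
    · rw [map_smul, M.dH_mul, M.dH_J_rho_replicate_two hr, mul_zero, zero_add,
        show 2 * (r - 1) + 3 = 2 * r + 1 by omega, M.dH_J_rho_self hr,
        show n - 1 - (r - 1) = n - r by omega, show r - 1 + 1 = r by omega, mul_smul_comm, mul_one,
        smul_smul]
    · intro i hi hne
      rw [map_smul, M.dH_mul, M.dH_J_rho_replicate_two hr, mul_zero, zero_add,
        M.dH_J_rho_singleton hr (by omega) (by omega), mul_zero, smul_zero]
    · intro h'
      exact absurd (Finset.mem_range.2 (by omega)) h'
  have h0 : (-1 : ℚ) ^ (r + 1) * M.coeff r (M.J (rho [2 * r + 1])) +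
      (-1 : ℚ) ^ r * M.coeff r (M.J (rho [2 * r + 1])) = 0 := by ring
  rw [h1, h2, ← add_smul, h0, zero_smul]

/-- The period of `Y_n` vanishes: the REAL identity
`∑_{a+b=n-1} ζ(2^a 3 2^b) = ∑_k (-1)^k ζ(2k+3) ζ(2^{n-1-k})` (alternating sum of the stuffle rows
for real multiple zeta values, `sum_multipleZeta_twos_insert_three`). [cite: Brown2012, proof of Lemma 3.8] -/
theorem per_Y {n : ℕ} (hn : 1 ≤ n) : M.per (M.Y n) = 0 := by
  rw [Y, map_add, map_sum, map_sum]
  have h1 : ∑ a ∈ Finset.range n, M.per (M.J (rho (tt a (n - 1 - a)))) =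
      ∑ k ∈ Finset.range n, (-1 : ℝ) ^ k *
        (multipleZeta [2 * k + 3] * multipleZeta (List.replicate (n - 1 - k) 2)) := by
    have e : ∀ a ∈ Finset.range n, M.per (M.J (rho (tt a (n - 1 - a)))) =
        (fun j => multipleZeta (List.replicate j 2 ++ 3 :: List.replicate (n - 1 - j) 2)) (n - 1 - a) := by
      intro a ha
      have ha' := Finset.mem_range.1 ha
      have := M.per_J (tt (n - 1 - a) a) (isHoffman_tt _ _).isAdmissible
      rw [reverse_tt] at this
      rw [this]
      simp only [tt, show n - 1 - (n - 1 - a) = a by omega]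
    rw [Finset.sum_congr rfl e, Finset.sum_range_reflect
      (fun j => multipleZeta (List.replicate j 2 ++ 3 :: List.replicate (n - 1 - j) 2)) n]
    obtain ⟨m, rfl⟩ : ∃ m, n = m + 1 := ⟨n - 1, by omega⟩
    simp only [Nat.add_sub_cancel]
    exact sum_multipleZeta_twos_insert_three m
  have h2 : ∑ i ∈ Finset.range n, M.per (((-1 : ℚ) ^ (i + 1)) •
      (M.J (rho [2 * i + 3]) * M.J (rho (List.replicate (n - 1 - i) 2)))) =
      ∑ i ∈ Finset.range n, (-1 : ℝ) ^ (i + 1) *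
        (multipleZeta [2 * i + 3] * multipleZeta (List.replicate (n - 1 - i) 2)) := by
    refine Finset.sum_congr rfl fun i _ => ?_
    have ha := M.per_J [2 * i + 3] (MZV.isAdmissible_singleton_of_two_le (by omega))
    rw [List.reverse_singleton] at ha
    have hb := M.per_J (List.replicate (n - 1 - i) 2) (isHoffman_replicate_two _).isAdmissible
    rw [List.reverse_replicate] at hb
    rw [map_smul, map_mul, ha, hb, Rat.smul_def]
    push_cast
    ring
  rw [h1, h2, ← Finset.sum_add_distrib]
  exact Finset.sum_eq_zero fun i _ => by ring

/-- **`Y_n = 0` for all `n ≥ 1`** (Lemma 3.8 lifted from the real identity, by induction on `n`):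
`∂ʰ_{<2n+1} Y_n = 0` by the induction hypothesis (`dH_Y_eq_zero`), so `Y_n ∈ ℚ ζᵐ(2n+1)`
(Theorem 3.3), and the period map with `ζ(2n+1) > 0` kills the constant — "the general method for
lifting relations from real multiple zeta values to their motivic versions".
[cite: Brown2012, Lemma 3.8 and Remark 2.2] -/
theorem Y_eq_zero : ∀ n : ℕ, 1 ≤ n → M.Y n = 0 := by
  intro n
  induction n using Nat.strong_induction_on with
  | _ n ih =>
  intro hn
  have hD : ∀ r : ℕ, 1 ≤ r → 2 * r + 1 < 2 * n + 1 → M.dH r (M.Y n) = 0 := fun r hr hlt =>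
    M.dH_Y_eq_zero hr (by omega) (ih r (by omega) hr)
  obtain ⟨c, hc⟩ := M.kernel (N := 2 * n + 1) (by omega) (M.Y_mem n) hD
  have hadm : IsAdmissible [2 * n + 1] := MZV.isAdmissible_singleton_of_two_le (by omega)
  have hper := M.per_Y hn
  have hperz : M.per (M.J (rho [2 * n + 1])) = multipleZeta [2 * n + 1] := by
    have := M.per_J [2 * n + 1] hadm
    rwa [List.reverse_singleton] at this
  rw [hc, map_smul, Rat.smul_def, hperz] at hper
  have hc0 : (c : ℝ) = 0 := by
    rcases mul_eq_zero.1 hper with h | h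
    · exact h
    · exact absurd h (multipleZeta_pos_of_isAdmissible_holds hadm).ne'
  rw [hc, show c = 0 by exact_mod_cast hc0, zero_smul]

/-- **Brown 2012, Lemma 3.8** (motivic: `ζᵐ₁(2^{n}) = 2 ∑_{i=1}^{n} (-1)^i ζᵐ(2i+1) ζᵐ(2^{n-i})`),
DERIVED — with no motivic stuffle — from (3.8) and `Y_n = 0`. [cite: Brown2012, Lemma 3.8] -/
theorem lemma_3_8 (n : ℕ) (hn : 1 ≤ n) : M.J (false :: rho (List.replicate n 2)) =
    (2 : ℚ) • ∑ i ∈ Finset.range n, ((-1 : ℚ) ^ (i + 1)) •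
      (M.J (rho [2 * i + 3]) * M.J (rho (List.replicate (n - 1 - i) 2))) := by
  have hY := M.Y_eq_zero n hn
  rw [Y, add_eq_zero_iff_eq_neg] at hY
  simp only [tt] at hY
  rw [M.zetaOne n hn, hY, Algebra.smul_def, map_ofNat]
  ring

/-! ### The normalisation (3.6): rescaling the letters `f_{2r+1}` of `𝒰` -/

/-- `α_r = [f_{2r+1}] φ(ζᵐ(2r+1))` for `r ≥ 1` (and `1` otherwise). [cite: Brown2012, Lemma 3.2] -/
noncomputable def α (r : ℕ) : ℚ := if 1 ≤ r then M.coeff r (M.J (rho [2 * r + 1])) else 1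

/-- `α_r = [f_{2r+1}] φ(ζᵐ(2r+1))` for `r ≥ 1`. [cite: Brown2012, Lemma 3.2] -/
theorem α_of_le {r : ℕ} (hr : 1 ≤ r) : M.α r = M.coeff r (M.J (rho [2 * r + 1])) := if_pos hr

/-- `α_r ≠ 0`. [cite: Brown2012, Lemma 3.2] -/
theorem α_ne_zero (r : ℕ) : M.α r ≠ 0 := by
  by_cases hr : 1 ≤ r
  · rw [M.α_of_le hr]; exact M.coeff_zeta_ne_zero hr
  · rw [α, if_neg hr]; exact one_ne_zero

/-- The rescaling factor of a monomial `f_{b₁} ⋯ f_{b_k}` of `𝒰'`: `∏ α_{(bᵢ-1)/2}⁻¹`.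
[cite: Brown2012, (3.6)] -/
noncomputable def wordScale (w : List ℕ) : ℚ := (w.map fun b => (M.α ((b - 1) / 2))⁻¹).prod

/-- `wordScale (b w) = α_{(b-1)/2}⁻¹ wordScale w`. [folklore] -/
theorem wordScale_cons (b : ℕ) (w : List ℕ) :
    M.wordScale (b :: w) = (M.α ((b - 1) / 2))⁻¹ * M.wordScale w := by
  simp [wordScale]

/-- `wordScale (f_{2r+1}) = α_r⁻¹`. [folklore] -/
theorem wordScale_singleton_odd (r : ℕ) : M.wordScale [2 * r + 1] = (M.α r)⁻¹ := by
  rw [wordScale_cons, show (2 * r + 1 - 1) / 2 = r by omega]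
  simp [wordScale]

/-- The rescaling factors are units. [folklore] -/
theorem wordScale_ne_zero (w : List ℕ) : M.wordScale w ≠ 0 := by
  induction w with
  | nil => simp [wordScale]
  | cons b w ih => rw [wordScale_cons]; exact mul_ne_zero (inv_ne_zero (M.α_ne_zero _)) ih

/-- The automorphism `ψ` of `𝒰 = ℚ⟨f₃,f₅,…⟩ ⊗ ℚ[f₂]` rescaling each letter `f_{2r+1}` by `α_r⁻¹`
(`f₂` fixed), by which Brown normalizes the isomorphism (2.22) to achieve (3.6).
[cite: Brown2012, (3.6)] -/
noncomputable def scaleU : (ℕ × List ℕ →₀ ℚ) →ₗ[ℚ] (ℕ × List ℕ →₀ ℚ) where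
  toFun y := Finsupp.ofSupportFinite (fun q => M.wordScale q.2 * y q)
    (y.support.finite_toSet.subset fun q hq => by
      simp only [Function.mem_support, ne_eq, Finset.mem_coe, Finsupp.mem_support_iff] at hq ⊢
      exact fun h => hq (by rw [h, mul_zero]))
  map_add' y y' := by
    ext q; simp only [Finsupp.ofSupportFinite_coe, Finsupp.add_apply]; ring
  map_smul' a y := by
    ext q; simp only [Finsupp.ofSupportFinite_coe, Finsupp.smul_apply, smul_eq_mul, RingHom.id_apply]
    ring

/-- `(ψ y)(f₂^m w) = wordScale(w) · y(f₂^m w)`. [folklore] -/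
@[simp] theorem scaleU_apply (y : ℕ × List ℕ →₀ ℚ) (q : ℕ × List ℕ) :
    M.scaleU y q = M.wordScale q.2 * y q := rfl

/-- `ψ` is injective. [folklore] -/
theorem scaleU_injective : Function.Injective M.scaleU := by
  intro y y' h
  ext q
  have := DFunLike.congr_fun h q
  rw [scaleU_apply, scaleU_apply] at this
  exact mul_left_cancel₀ (M.wordScale_ne_zero q.2) this

/-- `ψ` preserves the weight pieces `𝒰_N`. [folklore] -/
theorem scaleU_mem_uWeight {N : ℕ} {y : ℕ × List ℕ →₀ ℚ} (hy : y ∈ uWeight N) :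
    M.scaleU y ∈ uWeight N := by
  rw [uWeight, Finsupp.mem_supported] at hy ⊢
  intro q hq
  apply hy
  rw [Finset.mem_coe, Finsupp.mem_support_iff] at hq ⊢
  rw [scaleU_apply] at hq
  exact fun h => hq (by rw [h, mul_zero])

/-- `∂_{2r+1} ∘ ψ = α_r⁻¹ · ψ ∘ ∂_{2r+1}`. [folklore] -/
theorem dU_scaleU (r : ℕ) (y : ℕ × List ℕ →₀ ℚ) :
    dU r (M.scaleU y) = (M.α r)⁻¹ • M.scaleU (dU r y) := by
  ext ⟨m, w⟩
  simp only [dU_apply, scaleU_apply, Finsupp.smul_apply, smul_eq_mul, wordScale_cons,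
    show (2 * r + 1 - 1) / 2 = r by omega]
  ring

/-- **The normalised structure** ((3.6)): `φ` replaced by `ψ ∘ φ` and `∂ʰ_{2r+1}` by
`α_r⁻¹ ∂ʰ_{2r+1}`; all the axioms are preserved. [cite: Brown2012, (3.6)] -/
noncomputable def normalize : MotivicMZV where
  H := M.H
  Hw := M.Hw
  mul_mem := M.mul_mem
  J := M.J
  J_mem := M.J_mem
  J_nil := M.J_nil
  J_replicate := M.J_replicate
  per := M.per
  per_J := M.per_J
  φ := M.scaleU ∘ₗ M.φ
  φ_mem := fun N x hx => M.scaleU_mem_uWeight (M.φ_mem N x hx)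
  φ_inj := fun N _ hx _ hy h => M.φ_inj N hx hy (M.scaleU_injective h)
  dH := fun r => (M.α r)⁻¹ • M.dH r
  φ_dH := by
    intro r hr x
    simp only [LinearMap.comp_apply, LinearMap.smul_apply, map_smul]
    rw [M.φ_dH r hr x, M.dU_scaleU r]
  dH_mul := by
    intro r x y
    simp only [LinearMap.smul_apply, M.dH_mul, smul_add, mul_smul_comm]
  dH_J := by
    intro r hr v
    simp only [LinearMap.smul_apply, LinearMap.comp_apply, scaleU_apply]
    rw [M.dH_J r hr v, Finset.smul_sum]
    refine Finset.sum_congr rfl fun p _ => ?_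
    rw [smul_smul, wordScale_singleton_odd]
  coeff_mul := by
    intro r a b x y ha hb hx hy
    simp only [LinearMap.comp_apply, scaleU_apply]
    rw [M.coeff_mul r ha hb hx hy, mul_zero]
  zetaOne := M.zetaOne

/-- The normalisation condition (3.6) ON A STRUCTURE `M`: `[f_{2r+1}] φ(ζᵐ(2r+1)) = 1` for `r ≥ 1`.
This is a predicate `MotivicMZV → Prop` — the hypothesis "the isomorphism (2.22) has been normalised"
consumed by `toPreCoactionData` / `toUCoactionData` — and not a closed statement: Brown *chooses* the
isomorphism so that it holds ("We can therefore normalize our choice of isomorphism (2.22) so that …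
maps `ζᵐ(2n+1)` to `f_{2n+1}`"), which is the theorem `normalized_normalize` below; conversely every
structure has non-normalised rescalings (`exists_not_normalized`, `forall_normalized_iff_isEmpty`).
[cite: Brown2012, (3.6)] -/
def Normalized (M : MotivicMZV) : Prop := ∀ r : ℕ, 1 ≤ r → M.coeff r (M.J (rho [2 * r + 1])) = 1

/-- **(3.6)**: the normalised structure is normalised. [cite: Brown2012, (3.6)] -/
theorem normalized_normalize : M.normalize.Normalized := by
  intro r hr
  show (M.scaleU (M.φ (M.J (rho [2 * r + 1])))) (0, [2 * r + 1]) = 1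
  rw [scaleU_apply, wordScale_singleton_odd, M.α_of_le hr]
  exact inv_mul_cancel₀ (M.coeff_zeta_ne_zero hr)

/-! ### (3.6) is a choice: rescaling the letters of `𝒰` by arbitrary units

The automorphisms `f_{2r+1} ↦ c_r f_{2r+1}` (`c_r ∈ ℚ^×`, `f₂` fixed) of `𝒰` act on the structures
`MotivicMZV` over a fixed `(H, Iᵐ, per)`; `normalize` is the rescaling by `c = α⁻¹`
(`normalize_eq_rescale`), and rescaling a normalised structure by `c_r = 2` un-normalises it, so the
universal closure `∀ M, M.Normalized` of the predicate is equivalent to `IsEmpty MotivicMZV`. -/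

/-- The factor `∏ᵢ c_{(bᵢ-1)/2}` of a monomial `f_{b₁}⋯f_{b_k}` under the rescaling `f_{2r+1} ↦ c_r f_{2r+1}`
(`wordScale` is the case `c = α⁻¹`). [folklore] -/
def letterScale (c : ℕ → ℚ) (w : List ℕ) : ℚ := (w.map fun b => c ((b - 1) / 2)).prod

/-- `letterScale c (b w) = c_{(b-1)/2} · letterScale c w`. [folklore] -/
theorem letterScale_cons (c : ℕ → ℚ) (b : ℕ) (w : List ℕ) :
    letterScale c (b :: w) = c ((b - 1) / 2) * letterScale c w := by
  simp [letterScale]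

/-- `letterScale c (f_{2r+1}) = c_r`. [folklore] -/
theorem letterScale_singleton_odd (c : ℕ → ℚ) (r : ℕ) : letterScale c [2 * r + 1] = c r := by
  rw [letterScale_cons, show (2 * r + 1 - 1) / 2 = r by omega]
  simp [letterScale]

/-- The factors are units when the `c_r` are. [folklore] -/
theorem letterScale_ne_zero {c : ℕ → ℚ} (hc : ∀ r, c r ≠ 0) (w : List ℕ) : letterScale c w ≠ 0 := by
  induction w with
  | nil => simp [letterScale]
  | cons b w ih => rw [letterScale_cons]; exact mul_ne_zero (hc _) ih

/-- The endomorphism `f_{2r+1} ↦ c_r f_{2r+1}` (`f₂` fixed) of `𝒰 = ℚ⟨f₃,f₅,…⟩ ⊗ ℚ[f₂]`, an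
automorphism when the `c_r` are units (`scaleU` is the case `c = α⁻¹`). [folklore] -/
noncomputable def rescaleU (c : ℕ → ℚ) : (ℕ × List ℕ →₀ ℚ) →ₗ[ℚ] (ℕ × List ℕ →₀ ℚ) where
  toFun y := Finsupp.ofSupportFinite (fun q => letterScale c q.2 * y q)
    (y.support.finite_toSet.subset fun q hq => by
      simp only [Function.mem_support, ne_eq, Finset.mem_coe, Finsupp.mem_support_iff] at hq ⊢
      exact fun h => hq (by rw [h, mul_zero]))
  map_add' y y' := by
    ext q; simp only [Finsupp.ofSupportFinite_coe, Finsupp.add_apply]; ring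
  map_smul' a y := by
    ext q; simp only [Finsupp.ofSupportFinite_coe, Finsupp.smul_apply, smul_eq_mul, RingHom.id_apply]
    ring

/-- `(rescaleU c y)(f₂^m w) = letterScale c w · y(f₂^m w)`. [folklore] -/
@[simp] theorem rescaleU_apply (c : ℕ → ℚ) (y : ℕ × List ℕ →₀ ℚ) (q : ℕ × List ℕ) :
    rescaleU c y q = letterScale c q.2 * y q := rfl

/-- `rescaleU c` is injective for `c_r ∈ ℚ^×`. [folklore] -/
theorem rescaleU_injective {c : ℕ → ℚ} (hc : ∀ r, c r ≠ 0) : Function.Injective (rescaleU c) := by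
  intro y y' h
  ext q
  have := DFunLike.congr_fun h q
  rw [rescaleU_apply, rescaleU_apply] at this
  exact mul_left_cancel₀ (letterScale_ne_zero hc q.2) this

/-- `rescaleU c` preserves the weight pieces `𝒰_N`. [folklore] -/
theorem rescaleU_mem_uWeight (c : ℕ → ℚ) {N : ℕ} {y : ℕ × List ℕ →₀ ℚ} (hy : y ∈ uWeight N) :
    rescaleU c y ∈ uWeight N := by
  rw [uWeight, Finsupp.mem_supported] at hy ⊢
  intro q hq
  apply hy
  rw [Finset.mem_coe, Finsupp.mem_support_iff] at hq ⊢
  rw [rescaleU_apply] at hq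
  exact fun h => hq (by rw [h, mul_zero])

/-- `∂_{2r+1} ∘ rescaleU c = c_r · rescaleU c ∘ ∂_{2r+1}`. [folklore] -/
theorem dU_rescaleU (c : ℕ → ℚ) (r : ℕ) (y : ℕ × List ℕ →₀ ℚ) :
    dU r (rescaleU c y) = c r • rescaleU c (dU r y) := by
  ext ⟨m, w⟩
  simp only [dU_apply, rescaleU_apply, Finsupp.smul_apply, smul_eq_mul, letterScale_cons,
    show (2 * r + 1 - 1) / 2 = r by omega]
  ring

/-- **The rescaled structure**: `φ` replaced by `rescaleU c ∘ φ` and `∂ʰ_{2r+1}` by `c_r ∂ʰ_{2r+1}`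
(`c_r ∈ ℚ^×`); every axiom of `MotivicMZV` is preserved, exactly as for `normalize` (the case
`c = α⁻¹`). [cite: Brown2012, (3.6)] -/
noncomputable def rescale (c : ℕ → ℚ) (hc : ∀ r, c r ≠ 0) : MotivicMZV where
  H := M.H
  Hw := M.Hw
  mul_mem := M.mul_mem
  J := M.J
  J_mem := M.J_mem
  J_nil := M.J_nil
  J_replicate := M.J_replicate
  per := M.per
  per_J := M.per_J
  φ := rescaleU c ∘ₗ M.φ
  φ_mem := fun N x hx => rescaleU_mem_uWeight c (M.φ_mem N x hx)
  φ_inj := fun N _ hx _ hy h => M.φ_inj N hx hy (rescaleU_injective hc h)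
  dH := fun r => c r • M.dH r
  φ_dH := by
    intro r hr x
    simp only [LinearMap.comp_apply, LinearMap.smul_apply, map_smul]
    rw [M.φ_dH r hr x, dU_rescaleU c r]
  dH_mul := by
    intro r x y
    simp only [LinearMap.smul_apply, M.dH_mul, smul_add, mul_smul_comm]
  dH_J := by
    intro r hr v
    simp only [LinearMap.smul_apply, LinearMap.comp_apply, rescaleU_apply]
    rw [M.dH_J r hr v, Finset.smul_sum]
    refine Finset.sum_congr rfl fun p _ => ?_
    rw [smul_smul, letterScale_singleton_odd]
  coeff_mul := by
    intro r a b x y ha hb hx hy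
    simp only [LinearMap.comp_apply, rescaleU_apply]
    rw [M.coeff_mul r ha hb hx hy, mul_zero]
  zetaOne := M.zetaOne

/-- The `f_{2r+1}`-coefficient of the rescaled structure is `c_r` times the old one. [folklore] -/
theorem coeff_rescale (c : ℕ → ℚ) (hc : ∀ r, c r ≠ 0) (r : ℕ) (x : M.H) :
    (M.rescale c hc).coeff r x = c r * M.coeff r x := by
  show rescaleU c (M.φ x) (0, [2 * r + 1]) = c r * M.φ x (0, [2 * r + 1])
  rw [rescaleU_apply, letterScale_singleton_odd]

/-- `normalize` is the rescaling by `c = α⁻¹`. [cite: Brown2012, (3.6)] -/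
theorem normalize_eq_rescale :
    M.normalize = M.rescale (fun r => (M.α r)⁻¹) (fun r => inv_ne_zero (M.α_ne_zero r)) := rfl

/-- Rescaling a normalised structure by `c_r = 2` un-normalises it: from any `MotivicMZV` a
non-normalised one. [folklore] -/
theorem exists_not_normalized (M : MotivicMZV) : ∃ M' : MotivicMZV, ¬ M'.Normalized := by
  refine ⟨M.normalize.rescale (fun _ => 2) (fun _ => two_ne_zero), fun h => ?_⟩
  have h1 : (M.normalize.rescale (fun _ => 2) (fun _ => two_ne_zero)).coeff 1 (M.J (rho [2 * 1 + 1])) = 1 :=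
    h 1 le_rfl
  have h2 : M.normalize.coeff 1 (M.J (rho [2 * 1 + 1])) = 1 := M.normalized_normalize 1 le_rfl
  rw [coeff_rescale, h2] at h1
  norm_num at h1

/-- **`Normalized` is a hypothesis on `M`, not a property of every `M`**: the universal closure
`∀ M, M.Normalized` holds iff `MotivicMZV` is empty (whereas §2 of the paper constructs an inhabitant).
[folklore] -/
theorem forall_normalized_iff_isEmpty : (∀ M : MotivicMZV, M.Normalized) ↔ IsEmpty MotivicMZV :=
  ⟨fun h => ⟨fun M => (exists_not_normalized M).elim fun M' hM' => hM' (h M')⟩, fun h M => h.elim M⟩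

/-! ### Brown's `UCoactionData` from the normalised structure -/

/-- **`PreCoactionData` from `MotivicMZV`** (normalised): `𝔏_{2r+1} := ℚ`, `π_r := [f_{2r+1}] ∘ φ`,
`D_{2r+1} := 1 ⊗ ∂ʰ_{2r+1}`, `(ζ_{2r+1} ↦ 1) := id`, Lemma 3.8 a theorem.
[cite: Brown2012, Definition 3.1, (3.3), (3.4), (5.5), Lemma 3.8] -/
noncomputable def toPreCoactionData (hM : M.Normalized) : PreCoactionData where
  H := M.H
  J := M.J
  Hw := M.Hw
  J_mem := M.J_mem
  mul_mem := M.mul_mem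
  J_nil := M.J_nil
  J_replicate := M.J_replicate
  L := fun _ => ℚ
  π := M.coeff
  π_mul := fun r _ _ _ _ ha hb hx hy => M.coeff_mul r ha hb hx hy
  D := fun r => (TensorProduct.mk ℚ ℚ M.H 1) ∘ₗ M.dH r
  D_mul := by
    intro r x y
    simp only [LinearMap.comp_apply, TensorProduct.mk_apply, M.dH_mul, TensorProduct.tmul_add,
      LinearMap.lTensor_tmul, LinearMap.mulLeft_apply]
  coaction := by
    intro r hr v
    simp only [LinearMap.comp_apply, TensorProduct.mk_apply]
    rw [M.dH_J r hr v, TensorProduct.tmul_sum]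
    refine Finset.sum_congr rfl fun p _ => ?_
    rw [TensorProduct.tmul_smul, TensorProduct.smul_tmul', smul_eq_mul, mul_one, coeff_apply]
  dualζ := fun _ => LinearMap.id
  dualζ_ζ := fun r hr => by simpa using hM r hr
  lemma_3_8 := M.lemma_3_8
  per := M.per
  per_J := M.per_J

/-- The component `Dc_r` of the pre-coaction data is `∂ʰ_{2r+1}`. [folklore] -/
theorem toPreCoactionData_Dc (hM : M.Normalized) (r : ℕ) (x : M.H) :
    (M.toPreCoactionData hM).Dc r x = M.dH r x := by
  show (TensorProduct.lid ℚ M.H) (TensorProduct.map LinearMap.id LinearMap.id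
    ((1 : ℚ) ⊗ₜ[ℚ] M.dH r x)) = M.dH r x
  rw [TensorProduct.map_tmul, LinearMap.id_apply, LinearMap.id_apply, TensorProduct.lid_tmul, one_smul]

/-- **Brown's `UCoactionData` from `MotivicMZV`**: with `φ`, the comodule property `φ_D` and the
DERIVED `φ(ζᵐ(N)) ∈ ℚ^× f_N`; hence Theorem 3.3 and `dim H_N ≤ d_N` (`UCoactionData.kernel`,
`UCoactionData.finrank_le`). [cite: Brown2012, (2.15), (2.22), (3.6), Theorem 3.3] -/
noncomputable def toUCoactionData (hM : M.Normalized) : UCoactionData where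
  toPreCoactionData := M.toPreCoactionData hM
  φ := M.φ
  φ_mem := M.φ_mem
  φ_inj := M.φ_inj
  φ_D := by
    intro r hr x
    show M.φ ((M.toPreCoactionData hM).Dc r x) = dU r (M.φ x)
    rw [toPreCoactionData_Dc]
    exact M.φ_dH r hr x
  φ_zeta := fun _ hN => M.φ_zeta hN

end MotivicMZV

end Brown2012

/-- **Brown's Hoffman theorem from the motivic input of §2 alone** (`MotivicMZV`: motivic MZVs with
period map, the embedding `H ↪ 𝒰` intertwining Goncharov's infinitesimal coaction with `∂_{2r+1}`,
and (3.8)): lift Lemma 3.8 from the real identity, normalise by (3.6), derive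
`φ(ζᵐ(N)) ∈ ℚ^× f_N`, Theorem 3.3 and the dimension bound, then §§3–7 (`BrownDepthOneLift`,
`BrownCoactionCalculus`, `BrownLinearIndependence`) with Zagier's theorem (`BrownZagierFormulaProofs`).
[cite: Brown2012, Theorem 1.1 and §7.2] -/
theorem hoffmanSpan_eq_mzvSpace_of_motivicMZV (M : Brown2012.MotivicMZV) : hoffmanSpan_eq_mzvSpace :=
  hoffmanSpan_eq_mzvSpace_of_uCoactionData' (M.normalize.toUCoactionData M.normalized_normalize)

/-- **Terasoma's bound `dim 𝒵_N ≤ d_N` from the same motivic input** (Brown 2012, (7.2):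
`dim H_N = d_N`, and the period map is onto `𝒵_N`). [cite: Brown2012, (7.2) and Corollary 7.5] -/
theorem finrank_mzvSpace_le_zagierDim_of_motivicMZV (M : Brown2012.MotivicMZV) :
    finrank_mzvSpace_le_zagierDim :=
  finrank_mzvSpace_le_zagierDim_of_hoffmanSpan_eq (hoffmanSpan_eq_mzvSpace_of_motivicMZV M)

end Literature.NumberTheory.Transcendental
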